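import Mathlib
import HarnessLib
import Summits.HubbardSuperconductivity.HubbardSuperconductivity.Theorems.KLProgrammeKLRegimeCountertermV7Volume
import Summits.HubbardSuperconductivity.HubbardSuperconductivity.Theorems.KLProgrammeKLRegimeSplitBundleV11

/-!
# Route `KLProgramme` — the COUNTERTERM child of the gen-3 K3 resplit, `CountertermP2 klPredsV11 klWindowC` (route decl `KLRegimeCountertermV11`
# once filed; gen-2 item stmt-HubbardSuperconductivity-19664 `KLRegimeCountertermV7`): REDUCTION TO THE ONE-VOLUME CONSTRUCTION at the V11 bundle —
# the volume transfer by (E3f) PROVED (crux K3 stmt-HubbardSuperconductivity-19937; seat hubbard-kl-k3c5-p1 g2, for the p2 lineage)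

This module is the `klPredsV11` twin of `KLProgrammeKLRegimeCountertermV7Volume` (p451758, seat p2 g4) and of `…CountertermV10Volume` (p461268).
Between V10 and V11 the two-leg slot gained the Δ20 multi-slot sizes conjunct (E3a-MS) `TwoLegSizesMS` (k3c3-p2's repair (R-ms) of «Δ-stage»,
`…SplitTwoLegMultiSlot`; plan g10 ruling 2026-08-26T19:02:59Z); the engine slot (`EngineBoundsAtV7S`) and the history (`histV10`) are V10's, so
`TwoLegStepV11 = TwoLegStepG histV10 ∧ TwoLegSizesMS ∧ TwoLegAngularG ∧ TwoLegVolumeRate (histV10 ∧ TwoLegStepG histV10 ∧ TwoLegSizesMS ∧ TwoLegAngularG)`.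
Child 2's renormalisation package `ctRen G` and tolerance `ctCr G` are unchanged and imported.  What changes for child 2 is bookkeeping only:

* the hypothesis block `CtHypV11` reads the V11 slots (`EngineBoundsAtV7S`, `TwoLegStepV11`, `BetaSplitAtS2`);
* the (E3f) comparison-volume antecedent of `TwoLegStepV11` carries TWO conjuncts more than V7's ((E3a-MS), (E3g)), both supplied at the target
  volume by the same hypothesis block (`TwoLegStepV11` there carries them as its second and third conjuncts);
* the one-volume construction `CtOneVolumeV11` is `CtOneVolume` verbatim on `CtHypV11` — its conclusion (the local parts at ONE volume `(L₀, M₀)`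
  within HALF the quadratic tolerance at EVERY real angle) is the target of k3c3-p2's wholesale scale-by-scale continuation on the repaired slots:
  (E3a-MS) for the self-map of the admissible ball at fine-structured frames, (E3c) for the contraction, the node identity + tails for the
  lattice-angle smallness, (E3g) + the flat-tube lattice-angle net (`renormalisedAtF_of_grid`) for every real angle.

PROVED here: the volume transfer `ct_volumeTransferV11` (strong induction on the scale at the target volume, as in V7/V10) and the composition
`countertermP2_klPredsV11_of : (∀ G P Q, G.WF → P.WF → Q.WF → CtOneVolumeV11 G P Q) → CountertermP2 klPredsV11 klWindowC` — the gen-3 counterterm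
child closes from ONE registered stub, `stub_ct_oneVolume : CtOneVolumeV11 G P Q`; plus the accessors of the block the stub provers consume
(`CtHypV11.twoLegStepG / .twoLegSizesMS / .twoLegAngularG / .volumeRate`).  Two definitions + proofs; nothing is asserted about the model.
-/

noncomputable section

namespace Summit.HubbardSuperconductivity.HubbardSuperconductivity.Theorems.KLRegimeSplit

set_option linter.dupNamespace false -- summit = problem name (single-conjunct summit), D-0017

open Real Finset Literature.MathematicalPhysics.QuantumLattice Literature.Probability.LatticeModels
open Summit.HubbardSuperconductivity.HubbardSuperconductivity.Theorems.KLProgrammeLegKernels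

section Model

/-- **Child 2's hypothesis block at the V11 bundle** at `(G, P, Q, β, U, μ)` beyond thresholds `(Lh, Mh)`: every admissible frame (for child 2's
package `ctRen G`), at every large volume and every scale, renormalised below the scale ⇒ the engine output `EngineBoundsAtV7S`, the V11 two-leg
step `TwoLegStepV11` (incl. (E3a-MS), (E3g) and the (E3f) rate) and the split `BetaSplitAtS2` at the scale. -/
def CtHypV11 (G : GeoConsts) (P : SplitConsts) (Q : EngConsts) (β U μ : ℝ) (Lh : ℕ) (Mh : ℕ → ℕ) : Prop :=
  ∀ K : TrigPolyC4v, FrameOK (ctRen G) U (nScales β) μ K →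
    ∀ (L M : ℕ) [NeZero L] [NeZero M], Lh ≤ L → Mh L ≤ M →
      ∀ n : ℕ, n ≤ nScales β → (∀ j < n, RenormalisedAtF L M β U μ K (ctRen G) j) →
        EngineBoundsAtV7S L M G P Q β U μ K n ∧ TwoLegStepV11 L M G P Q (ctRen G) β U μ K n ∧ BetaSplitAtS2 L M G P Q β U μ K n

end Model

/-- **The ONE-VOLUME CONSTRUCTION at the V11 bundle** (the one stub of the gen-3 counterterm child; `CtOneVolume` verbatim on `CtHypV11`).  For
the constants `(G, P, Q)`: there are `c₁, U₀` such that, in the regime, from the V11 hypothesis block beyond `(Lh, Mh)` one builds at ONE volume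
`(L₀, M₀) ≥ (Lh, Mh L₀)`, `M₀ ≥ Q.M0 β L₀`, an ADMISSIBLE frame `K` whose local parts at `(L₀, M₀)` are within HALF the quadratic tolerance at every
scale and every real angle, with `L₀` so large that the volume rate `Q.CL β n / L₀` fits in the other half. -/
def CtOneVolumeV11 (G : GeoConsts) (P : SplitConsts) (Q : EngConsts) : Prop :=
    ∃ c₁ : ℝ, 0 < c₁ ∧ ∀ c : ℝ, 0 < c → c ≤ c₁ → ∃ U₀ : ℝ, 0 < U₀ ∧
      ∀ μ ∈ klWindowC, ∀ U : ℝ, 0 < U → U ≤ U₀ → ∀ β : ℝ, klBetaMin ≤ β → β ≤ Real.exp (c / U ^ 2) →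
        ∀ (Lh : ℕ) (Mh : ℕ → ℕ), CtHypV11 G P Q β U μ Lh Mh →
          ∃ K : TrigPolyC4v, FrameOK (ctRen G) U (nScales β) μ K ∧
            ∃ (L₀ M₀ : ℕ), 0 < L₀ ∧ 0 < M₀ ∧ Lh ≤ L₀ ∧ Mh L₀ ≤ M₀ ∧ Q.M0 β L₀ ≤ M₀ ∧
              (∀ (_ : NeZero L₀) (_ : NeZero M₀), ∀ n : ℕ, n ≤ nScales β →
                (∀ θ : ℝ, |klLocalPart L₀ M₀ β U μ K n θ| ≤ ctCr G * |U| * klScale klE0 n ^ 2 / klE0 / 2) ∧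
                Q.CL β n / L₀ ≤ ctCr G * |U| * klScale klE0 n ^ 2 / klE0 / 2)

section Accessors

variable {G : GeoConsts} {P : SplitConsts} {Q : EngConsts} {β U μ : ℝ} {Lh : ℕ} {Mh : ℕ → ℕ}

/-- **The V11 block yields the full (E3f) comparison antecedent at any large volume carrying the renormalisation history**:
`histV10 ∧ TwoLegStepG histV10 ∧ TwoLegSizesMS ∧ TwoLegAngularG` below `n`. -/
theorem CtHypV11.rateAntecedent (hyp : CtHypV11 G P Q β U μ Lh Mh) {K : TrigPolyC4v} (hK : FrameOK (ctRen G) U (nScales β) μ K)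
    {L M : ℕ} [NeZero L] [NeZero M] (hL : Lh ≤ L) (hM : Mh L ≤ M) {n : ℕ} (hn : n ≤ nScales β)
    (hren : ∀ j < n, RenormalisedAtF L M β U μ K (ctRen G) j) :
    ∀ j < n, histV10 L M G P Q (ctRen G) β U μ K j ∧
      TwoLegStepG L M (histV10 L M G P Q (ctRen G) β U μ) G P Q (ctRen G) β U μ K j ∧
        TwoLegSizesMS L M G Q (ctRen G) β U μ K j ∧ TwoLegAngularG L M G Q (ctRen G) β U μ K j := by
  intro j hj
  have hs := hyp K hK L M hL hM j (le_of_lt (lt_of_lt_of_le hj hn)) fun i hi => hren i (hi.trans hj)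
  exact ⟨⟨hs.2.2, hren j hj, hs.1⟩, hs.2.1.1, hs.2.1.2.1, hs.2.1.2.2.1⟩

/-- **The V11 block yields the «G» two-leg step for renormalised frames** (sizes, floor, frame-Lipschitz at the V10 history, slopes). -/
theorem CtHypV11.twoLegStepG (hyp : CtHypV11 G P Q β U μ Lh Mh) {K : TrigPolyC4v} (hK : FrameOK (ctRen G) U (nScales β) μ K)
    {L M : ℕ} [NeZero L] [NeZero M] (hL : Lh ≤ L) (hM : Mh L ≤ M) {n : ℕ} (hn : n ≤ nScales β)
    (hren : ∀ j < n, RenormalisedAtF L M β U μ K (ctRen G) j) :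
    TwoLegStepG L M (histV10 L M G P Q (ctRen G) β U μ) G P Q (ctRen G) β U μ K n :=
  (hyp K hK L M hL hM n hn hren).2.1.1

/-- **The V11 block yields (E3a-MS) for renormalised frames** (the multi-slot sizes of the scale-`n` piece at fine-structured frames — the
self-map input of the wholesale continuation). -/
theorem CtHypV11.twoLegSizesMS (hyp : CtHypV11 G P Q β U μ Lh Mh) {K : TrigPolyC4v} (hK : FrameOK (ctRen G) U (nScales β) μ K)
    {L M : ℕ} [NeZero L] [NeZero M] (hL : Lh ≤ L) (hM : Mh L ≤ M) {n : ℕ} (hn : n ≤ nScales β)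
    (hren : ∀ j < n, RenormalisedAtF L M β U μ K (ctRen G) j) :
    TwoLegSizesMS L M G Q (ctRen G) β U μ K n :=
  (hyp K hK L M hL hM n hn hren).2.1.2.1

/-- **The V11 block yields (E3g) for renormalised frames** (`θ ↦ ν_n(K)(θ)` is `C⁴` with the `angBar` derivative bounds — the conjunct that
passes from the lattice angles to every real angle, `renormalisedAtF_of_grid`). -/
theorem CtHypV11.twoLegAngularG (hyp : CtHypV11 G P Q β U μ Lh Mh) {K : TrigPolyC4v} (hK : FrameOK (ctRen G) U (nScales β) μ K)
    {L M : ℕ} [NeZero L] [NeZero M] (hL : Lh ≤ L) (hM : Mh L ≤ M) {n : ℕ} (hn : n ≤ nScales β)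
    (hren : ∀ j < n, RenormalisedAtF L M β U μ K (ctRen G) j) :
    TwoLegAngularG L M G Q (ctRen G) β U μ K n :=
  (hyp K hK L M hL hM n hn hren).2.1.2.2.1

/-- **The V11 block yields the (E3f) volume rate between two volumes carrying the renormalisation history**: if `K` is renormalised below
`n` at `(L, M)` and at `(L′, M′)`, `L ≤ L′`, both beyond the thresholds and the Matsubara thresholds `Q.M0`, then
`|ν_n^{L,M}(θ) − ν_n^{L′,M′}(θ)| ≤ Q.CL β n / L` at every angle. -/
theorem CtHypV11.volumeRate (hyp : CtHypV11 G P Q β U μ Lh Mh) {K : TrigPolyC4v} (hK : FrameOK (ctRen G) U (nScales β) μ K)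
    {L M : ℕ} [NeZero L] [NeZero M] (hL : Lh ≤ L) (hM : Mh L ≤ M) (hM0 : Q.M0 β L ≤ M) {L' M' : ℕ} [NeZero L'] [NeZero M']
    (hLL' : L ≤ L') (hM' : Mh L' ≤ M') (hM0' : Q.M0 β L' ≤ M') {n : ℕ} (hn : n ≤ nScales β)
    (hren : ∀ j < n, RenormalisedAtF L M β U μ K (ctRen G) j) (hren' : ∀ j < n, RenormalisedAtF L' M' β U μ K (ctRen G) j) (θ : ℝ) :
    |klLocalPart L M β U μ K n θ - klLocalPart L' M' β U μ K n θ| ≤ Q.CL β n / L :=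
  (hyp K hK L M hL hM n hn hren).2.1.2.2.2 hM0 L' M' hLL' hM0' (hyp.rateAntecedent hK (hL.trans hLL') hM' hn hren') θ

end Accessors

/-- **VOLUME TRANSFER at the V11 bundle (PROVED).**  From the one-volume frame and the V11 hypothesis block: at every volume `(L, M)` with
`L₀ ≤ L`, `max (Mh L) (Q.M0 β L) ≤ M`, upward (strong) induction on `n` — the renormalisation of `K` at `(L, M)` below `n` gives, through the block,
the V11 comparison antecedent there below `n` (`CtHypV11.rateAntecedent`), which the (E3f) clause of `TwoLegStepV11` at the construction volume
`(L₀, M₀)` consumes; so `|ν_n^{L,M}| ≤ ½tol + Q.CL β n / L₀ ≤ tol`. -/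
theorem ct_volumeTransferV11 (G : GeoConsts) (P : SplitConsts) (Q : EngConsts) (hG : G.WF) {β U μ : ℝ} {Lh : ℕ} {Mh : ℕ → ℕ}
    (hyp : CtHypV11 G P Q β U μ Lh Mh) {K : TrigPolyC4v} (hK : FrameOK (ctRen G) U (nScales β) μ K) {L₀ M₀ : ℕ} [NeZero L₀] [NeZero M₀]
    (hL₀ : Lh ≤ L₀) (hM₀ : Mh L₀ ≤ M₀) (hM₀' : Q.M0 β L₀ ≤ M₀)
    (hhalf : ∀ n : ℕ, n ≤ nScales β →
      (∀ θ : ℝ, |klLocalPart L₀ M₀ β U μ K n θ| ≤ ctCr G * |U| * klScale klE0 n ^ 2 / klE0 / 2) ∧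
      Q.CL β n / L₀ ≤ ctCr G * |U| * klScale klE0 n ^ 2 / klE0 / 2) :
    ∀ (L M : ℕ) [NeZero L] [NeZero M], L₀ ≤ L → max (Mh L) (Q.M0 β L) ≤ M →
      ∀ n : ℕ, n ≤ nScales β → RenormalisedAtF L M β U μ K (ctRen G) n := by
  -- the half tolerance is nonnegative
  have htol_nonneg : ∀ n, 0 ≤ ctCr G * |U| * klScale klE0 n ^ 2 / klE0 / 2 := by
    intro n
    have hS : ∀ j, 0 ≤ G.S j := hG.2.2.2.2.2.2.2.2.2.2.2.2.2.2.2.2.2.1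
    have hcr : 0 ≤ ctCr G := by unfold ctCr; nlinarith [hS 0]
    have he0 : (0:ℝ) < klE0 := by norm_num [klE0]
    positivity
  -- renormalisation at the construction volume, at every scale (half tolerance ≤ tolerance)
  have hren0 : ∀ n, n ≤ nScales β → RenormalisedAtF L₀ M₀ β U μ K (ctRen G) n := by
    intro n hn θ
    have h := (hhalf n hn).1 θ
    show |klLocalPart L₀ M₀ β U μ K n θ| ≤ ctCr G * |U| * klScale klE0 n ^ 2 / klE0
    linarith [htol_nonneg n]
  intro L M _ _ hL hM
  have hMh : Mh L ≤ M := (le_max_left _ _).trans hM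
  have hM0 : Q.M0 β L ≤ M := (le_max_right _ _).trans hM
  -- strong induction on the scale at the target volume
  intro n
  induction n using Nat.strong_induction_on with
  | _ n ih =>
    intro hn θ
    -- history at the target volume below `n`
    have hrenL : ∀ j < n, RenormalisedAtF L M β U μ K (ctRen G) j := fun j hj =>
      ih j hj (le_of_lt (lt_of_lt_of_le hj hn))
    -- the (E3f) rate between the construction volume and the target volume at scale `n`
    have hrate := hyp.volumeRate hK hL₀ hM₀ hM₀' hL hMh hM0 hn
      (fun j hj => hren0 j (le_of_lt (lt_of_lt_of_le hj hn))) hrenL θ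
    have hhalfθ := (hhalf n hn).1 θ
    have hCL := (hhalf n hn).2
    show |klLocalPart L M β U μ K n θ| ≤ ctCr G * |U| * klScale klE0 n ^ 2 / klE0
    have htri : |klLocalPart L M β U μ K n θ| ≤
        |klLocalPart L₀ M₀ β U μ K n θ| + |klLocalPart L₀ M₀ β U μ K n θ - klLocalPart L M β U μ K n θ| := by
      have h1 := abs_sub_abs_le_abs_sub (klLocalPart L M β U μ K n θ) (klLocalPart L₀ M₀ β U μ K n θ)
      rw [abs_sub_comm] at h1
      linarith
    linarith

/-- **COMPOSITION: the gen-3 counterterm child at the V11 bundle follows from the one-volume construction alone** (`CtOneVolumeV11` for all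
well-formed constants) — the volume transfer is proved above; the renormalisation package is `ctRen G` (Δ8: a function of `G` alone), the
common Matsubara threshold is `Mc L = max (Mh L) (Q.M0 β L)`. -/
theorem countertermP2_klPredsV11_of (hone : ∀ G P Q, G.WF → P.WF → Q.WF → CtOneVolumeV11 G P Q) :
    CountertermP2 klPredsV11 klWindowC := by
  intro G P hG hP
  refine ⟨ctRen G, ctRen_WF2 hG, fun Q hQ => ?_⟩
  obtain ⟨c₁, hc₁, hc⟩ := hone G P Q hG hP hQ
  refine ⟨c₁, hc₁, fun c hc0 hcc => ?_⟩
  obtain ⟨U₀, hU₀, hmain⟩ := hc c hc0 hcc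
  refine ⟨U₀, hU₀, fun μ hμ U hU hUle β hβ hβc Lh Mh hhyp => ?_⟩
  have hyp : CtHypV11 G P Q β U μ Lh Mh := fun K hK L M _ _ hL hM n hn hren =>
    hhyp K hK L M hL hM n hn hren
  obtain ⟨K, hK, L₀, M₀, hL₀pos, hM₀pos, hL₀, hM₀, hM₀', hhalf⟩ := hmain μ hμ U hU hUle β hβ hβc Lh Mh hyp
  haveI : NeZero L₀ := ⟨Nat.pos_iff_ne_zero.mp hL₀pos⟩
  haveI : NeZero M₀ := ⟨Nat.pos_iff_ne_zero.mp hM₀pos⟩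
  refine ⟨K, hK, L₀, fun L => max (Mh L) (Q.M0 β L), fun L M _ _ hL hM n hn => ?_⟩
  exact ct_volumeTransferV11 G P Q hG hyp hK hL₀ hM₀ hM₀' (hhalf inferInstance inferInstance) L M hL hM n hn

/-! ## §2 The gen-3 package OF RECORD: `ctRenMs` (frame allowance doubled for the multi-slot self-map) — supersedes §1's `ctRen`-based block

hubbard-kl-k3c3-p2 (HOME/STATUS 2026-08-26T19:23:20Z): the wholesale continuation's self-map under (E3a-MS) (`frameOK_of_multiSlot`, p463628) needs
`2(S_j + S′_j|U|) ≤ R.Gfr j`, which V7's package `ctRen G` (`Gfr j = S_j + 1`) does not give; child 2 CHOOSES `R` (Δ8, `CountertermP2`'s `∃ R` after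
`G, P`), so the package is simply widened.  The decls of §1 (`CtHypV11`, `CtOneVolumeV11`, …, landed p463772) are kept verbatim (append-only) and are
SUPERSEDED by the `Ms` twins below; the registered stub of stmt-HubbardSuperconductivity-19825 is re-registered on `CtOneVolumeMsV11`. -/

/-- **Child 2's renormalisation package, gen 3** — a function of `G` alone (Δ8: chosen before `Q`): `cr = ctCr G`, `cz = 1`,
`Gfr j = 2·(G.S j + 1)` (room for the multi-slot self-map: `2(S_j + S′_j|U|) ≤ Gfr j` once `S′_j|U| ≤ 1`). -/
def ctRenMs (G : GeoConsts) : RenConsts := ⟨ctCr G, 1, fun j => 2 * (G.S j + 1)⟩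

/-- `ctRenMs G` is well formed with positive tolerances when `G` is. -/
theorem ctRenMs_WF2 {G : GeoConsts} (hG : G.WF) : (ctRenMs G).WF2 := by
  have hS : ∀ j, 0 ≤ G.S j := hG.2.2.2.2.2.2.2.2.2.2.2.2.2.2.2.2.2.1
  refine ⟨⟨?_, ?_, ?_⟩, ?_, ?_⟩
  · show 0 ≤ ctCr G; unfold ctCr; nlinarith [hS 0]
  · show (0 : ℝ) ≤ 1; norm_num
  · intro j; show 0 ≤ 2 * (G.S j + 1); linarith [hS j]
  · show 0 < ctCr G; unfold ctCr; nlinarith [hS 0]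
  · show (0 : ℝ) < 1; norm_num

/-- The frame allowance of `ctRenMs` absorbs the multi-slot sizes: `2·(S_j + S′_j·|U|) ≤ (ctRenMs G).Gfr j` whenever `S′_j·|U| ≤ 1`. -/
theorem two_mul_add_le_ctRenMs_Gfr (G : GeoConsts) {S' U : ℝ} (j : ℕ) (h : S' * |U| ≤ 1) :
    2 * (G.S j + S' * |U|) ≤ (ctRenMs G).Gfr j := by
  show 2 * (G.S j + S' * |U|) ≤ 2 * (G.S j + 1)
  linarith

section ModelMs

/-- **Child 2's hypothesis block at the V11 bundle** at `(G, P, Q, β, U, μ)` beyond thresholds `(Lh, Mh)`: every admissible frame (for child 2's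
package `ctRenMs G`), at every large volume and every scale, renormalised below the scale ⇒ the engine output `EngineBoundsAtV7S`, the V11 two-leg
step `TwoLegStepV11` (incl. (E3a-MS), (E3g) and the (E3f) rate) and the split `BetaSplitAtS2` at the scale. -/
def CtHypMsV11 (G : GeoConsts) (P : SplitConsts) (Q : EngConsts) (β U μ : ℝ) (Lh : ℕ) (Mh : ℕ → ℕ) : Prop :=
  ∀ K : TrigPolyC4v, FrameOK (ctRenMs G) U (nScales β) μ K →
    ∀ (L M : ℕ) [NeZero L] [NeZero M], Lh ≤ L → Mh L ≤ M →
      ∀ n : ℕ, n ≤ nScales β → (∀ j < n, RenormalisedAtF L M β U μ K (ctRenMs G) j) →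
        EngineBoundsAtV7S L M G P Q β U μ K n ∧ TwoLegStepV11 L M G P Q (ctRenMs G) β U μ K n ∧ BetaSplitAtS2 L M G P Q β U μ K n

end ModelMs

/-- **The ONE-VOLUME CONSTRUCTION at the V11 bundle** (the one stub of the gen-3 counterterm child; `CtOneVolume` verbatim on `CtHypMsV11`).  For
the constants `(G, P, Q)`: there are `c₁, U₀` such that, in the regime, from the V11 hypothesis block beyond `(Lh, Mh)` one builds at ONE volume
`(L₀, M₀) ≥ (Lh, Mh L₀)`, `M₀ ≥ Q.M0 β L₀`, an ADMISSIBLE frame `K` whose local parts at `(L₀, M₀)` are within HALF the quadratic tolerance at every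
scale and every real angle, with `L₀` so large that the volume rate `Q.CL β n / L₀` fits in the other half. -/
def CtOneVolumeMsV11 (G : GeoConsts) (P : SplitConsts) (Q : EngConsts) : Prop :=
    ∃ c₁ : ℝ, 0 < c₁ ∧ ∀ c : ℝ, 0 < c → c ≤ c₁ → ∃ U₀ : ℝ, 0 < U₀ ∧
      ∀ μ ∈ klWindowC, ∀ U : ℝ, 0 < U → U ≤ U₀ → ∀ β : ℝ, klBetaMin ≤ β → β ≤ Real.exp (c / U ^ 2) →
        ∀ (Lh : ℕ) (Mh : ℕ → ℕ), CtHypMsV11 G P Q β U μ Lh Mh →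
          ∃ K : TrigPolyC4v, FrameOK (ctRenMs G) U (nScales β) μ K ∧
            ∃ (L₀ M₀ : ℕ), 0 < L₀ ∧ 0 < M₀ ∧ Lh ≤ L₀ ∧ Mh L₀ ≤ M₀ ∧ Q.M0 β L₀ ≤ M₀ ∧
              (∀ (_ : NeZero L₀) (_ : NeZero M₀), ∀ n : ℕ, n ≤ nScales β →
                (∀ θ : ℝ, |klLocalPart L₀ M₀ β U μ K n θ| ≤ ctCr G * |U| * klScale klE0 n ^ 2 / klE0 / 2) ∧
                Q.CL β n / L₀ ≤ ctCr G * |U| * klScale klE0 n ^ 2 / klE0 / 2)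

section AccessorsMs

variable {G : GeoConsts} {P : SplitConsts} {Q : EngConsts} {β U μ : ℝ} {Lh : ℕ} {Mh : ℕ → ℕ}

/-- **The V11 block yields the full (E3f) comparison antecedent at any large volume carrying the renormalisation history**:
`histV10 ∧ TwoLegStepG histV10 ∧ TwoLegSizesMS ∧ TwoLegAngularG` below `n`. -/
theorem CtHypMsV11.rateAntecedent (hyp : CtHypMsV11 G P Q β U μ Lh Mh) {K : TrigPolyC4v} (hK : FrameOK (ctRenMs G) U (nScales β) μ K)
    {L M : ℕ} [NeZero L] [NeZero M] (hL : Lh ≤ L) (hM : Mh L ≤ M) {n : ℕ} (hn : n ≤ nScales β)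
    (hren : ∀ j < n, RenormalisedAtF L M β U μ K (ctRenMs G) j) :
    ∀ j < n, histV10 L M G P Q (ctRenMs G) β U μ K j ∧
      TwoLegStepG L M (histV10 L M G P Q (ctRenMs G) β U μ) G P Q (ctRenMs G) β U μ K j ∧
        TwoLegSizesMS L M G Q (ctRenMs G) β U μ K j ∧ TwoLegAngularG L M G Q (ctRenMs G) β U μ K j := by
  intro j hj
  have hs := hyp K hK L M hL hM j (le_of_lt (lt_of_lt_of_le hj hn)) fun i hi => hren i (hi.trans hj)
  exact ⟨⟨hs.2.2, hren j hj, hs.1⟩, hs.2.1.1, hs.2.1.2.1, hs.2.1.2.2.1⟩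

/-- **The V11 block yields the «G» two-leg step for renormalised frames** (sizes, floor, frame-Lipschitz at the V10 history, slopes). -/
theorem CtHypMsV11.twoLegStepG (hyp : CtHypMsV11 G P Q β U μ Lh Mh) {K : TrigPolyC4v} (hK : FrameOK (ctRenMs G) U (nScales β) μ K)
    {L M : ℕ} [NeZero L] [NeZero M] (hL : Lh ≤ L) (hM : Mh L ≤ M) {n : ℕ} (hn : n ≤ nScales β)
    (hren : ∀ j < n, RenormalisedAtF L M β U μ K (ctRenMs G) j) :
    TwoLegStepG L M (histV10 L M G P Q (ctRenMs G) β U μ) G P Q (ctRenMs G) β U μ K n :=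
  (hyp K hK L M hL hM n hn hren).2.1.1

/-- **The V11 block yields (E3a-MS) for renormalised frames** (the multi-slot sizes of the scale-`n` piece at fine-structured frames — the
self-map input of the wholesale continuation). -/
theorem CtHypMsV11.twoLegSizesMS (hyp : CtHypMsV11 G P Q β U μ Lh Mh) {K : TrigPolyC4v} (hK : FrameOK (ctRenMs G) U (nScales β) μ K)
    {L M : ℕ} [NeZero L] [NeZero M] (hL : Lh ≤ L) (hM : Mh L ≤ M) {n : ℕ} (hn : n ≤ nScales β)
    (hren : ∀ j < n, RenormalisedAtF L M β U μ K (ctRenMs G) j) :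
    TwoLegSizesMS L M G Q (ctRenMs G) β U μ K n :=
  (hyp K hK L M hL hM n hn hren).2.1.2.1

/-- **The V11 block yields (E3g) for renormalised frames** (`θ ↦ ν_n(K)(θ)` is `C⁴` with the `angBar` derivative bounds — the conjunct that
passes from the lattice angles to every real angle, `renormalisedAtF_of_grid`). -/
theorem CtHypMsV11.twoLegAngularG (hyp : CtHypMsV11 G P Q β U μ Lh Mh) {K : TrigPolyC4v} (hK : FrameOK (ctRenMs G) U (nScales β) μ K)
    {L M : ℕ} [NeZero L] [NeZero M] (hL : Lh ≤ L) (hM : Mh L ≤ M) {n : ℕ} (hn : n ≤ nScales β)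
    (hren : ∀ j < n, RenormalisedAtF L M β U μ K (ctRenMs G) j) :
    TwoLegAngularG L M G Q (ctRenMs G) β U μ K n :=
  (hyp K hK L M hL hM n hn hren).2.1.2.2.1

/-- **The V11 block yields the (E3f) volume rate between two volumes carrying the renormalisation history**: if `K` is renormalised below
`n` at `(L, M)` and at `(L′, M′)`, `L ≤ L′`, both beyond the thresholds and the Matsubara thresholds `Q.M0`, then
`|ν_n^{L,M}(θ) − ν_n^{L′,M′}(θ)| ≤ Q.CL β n / L` at every angle. -/
theorem CtHypMsV11.volumeRate (hyp : CtHypMsV11 G P Q β U μ Lh Mh) {K : TrigPolyC4v} (hK : FrameOK (ctRenMs G) U (nScales β) μ K)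
    {L M : ℕ} [NeZero L] [NeZero M] (hL : Lh ≤ L) (hM : Mh L ≤ M) (hM0 : Q.M0 β L ≤ M) {L' M' : ℕ} [NeZero L'] [NeZero M']
    (hLL' : L ≤ L') (hM' : Mh L' ≤ M') (hM0' : Q.M0 β L' ≤ M') {n : ℕ} (hn : n ≤ nScales β)
    (hren : ∀ j < n, RenormalisedAtF L M β U μ K (ctRenMs G) j) (hren' : ∀ j < n, RenormalisedAtF L' M' β U μ K (ctRenMs G) j) (θ : ℝ) :
    |klLocalPart L M β U μ K n θ - klLocalPart L' M' β U μ K n θ| ≤ Q.CL β n / L :=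
  (hyp K hK L M hL hM n hn hren).2.1.2.2.2 hM0 L' M' hLL' hM0' (hyp.rateAntecedent hK (hL.trans hLL') hM' hn hren') θ

end AccessorsMs

/-- **VOLUME TRANSFER at the V11 bundle (PROVED).**  From the one-volume frame and the V11 hypothesis block: at every volume `(L, M)` with
`L₀ ≤ L`, `max (Mh L) (Q.M0 β L) ≤ M`, upward (strong) induction on `n` — the renormalisation of `K` at `(L, M)` below `n` gives, through the block,
the V11 comparison antecedent there below `n` (`CtHypMsV11.rateAntecedent`), which the (E3f) clause of `TwoLegStepV11` at the construction volume
`(L₀, M₀)` consumes; so `|ν_n^{L,M}| ≤ ½tol + Q.CL β n / L₀ ≤ tol`. -/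
theorem ct_volumeTransferMsV11 (G : GeoConsts) (P : SplitConsts) (Q : EngConsts) (hG : G.WF) {β U μ : ℝ} {Lh : ℕ} {Mh : ℕ → ℕ}
    (hyp : CtHypMsV11 G P Q β U μ Lh Mh) {K : TrigPolyC4v} (hK : FrameOK (ctRenMs G) U (nScales β) μ K) {L₀ M₀ : ℕ} [NeZero L₀] [NeZero M₀]
    (hL₀ : Lh ≤ L₀) (hM₀ : Mh L₀ ≤ M₀) (hM₀' : Q.M0 β L₀ ≤ M₀)
    (hhalf : ∀ n : ℕ, n ≤ nScales β →
      (∀ θ : ℝ, |klLocalPart L₀ M₀ β U μ K n θ| ≤ ctCr G * |U| * klScale klE0 n ^ 2 / klE0 / 2) ∧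
      Q.CL β n / L₀ ≤ ctCr G * |U| * klScale klE0 n ^ 2 / klE0 / 2) :
    ∀ (L M : ℕ) [NeZero L] [NeZero M], L₀ ≤ L → max (Mh L) (Q.M0 β L) ≤ M →
      ∀ n : ℕ, n ≤ nScales β → RenormalisedAtF L M β U μ K (ctRenMs G) n := by
  -- the half tolerance is nonnegative
  have htol_nonneg : ∀ n, 0 ≤ ctCr G * |U| * klScale klE0 n ^ 2 / klE0 / 2 := by
    intro n
    have hS : ∀ j, 0 ≤ G.S j := hG.2.2.2.2.2.2.2.2.2.2.2.2.2.2.2.2.2.1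
    have hcr : 0 ≤ ctCr G := by unfold ctCr; nlinarith [hS 0]
    have he0 : (0:ℝ) < klE0 := by norm_num [klE0]
    positivity
  -- renormalisation at the construction volume, at every scale (half tolerance ≤ tolerance)
  have hren0 : ∀ n, n ≤ nScales β → RenormalisedAtF L₀ M₀ β U μ K (ctRenMs G) n := by
    intro n hn θ
    have h := (hhalf n hn).1 θ
    show |klLocalPart L₀ M₀ β U μ K n θ| ≤ ctCr G * |U| * klScale klE0 n ^ 2 / klE0
    linarith [htol_nonneg n]
  intro L M _ _ hL hM
  have hMh : Mh L ≤ M := (le_max_left _ _).trans hM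
  have hM0 : Q.M0 β L ≤ M := (le_max_right _ _).trans hM
  -- strong induction on the scale at the target volume
  intro n
  induction n using Nat.strong_induction_on with
  | _ n ih =>
    intro hn θ
    -- history at the target volume below `n`
    have hrenL : ∀ j < n, RenormalisedAtF L M β U μ K (ctRenMs G) j := fun j hj =>
      ih j hj (le_of_lt (lt_of_lt_of_le hj hn))
    -- the (E3f) rate between the construction volume and the target volume at scale `n`
    have hrate := hyp.volumeRate hK hL₀ hM₀ hM₀' hL hMh hM0 hn
      (fun j hj => hren0 j (le_of_lt (lt_of_lt_of_le hj hn))) hrenL θ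
    have hhalfθ := (hhalf n hn).1 θ
    have hCL := (hhalf n hn).2
    show |klLocalPart L M β U μ K n θ| ≤ ctCr G * |U| * klScale klE0 n ^ 2 / klE0
    have htri : |klLocalPart L M β U μ K n θ| ≤
        |klLocalPart L₀ M₀ β U μ K n θ| + |klLocalPart L₀ M₀ β U μ K n θ - klLocalPart L M β U μ K n θ| := by
      have h1 := abs_sub_abs_le_abs_sub (klLocalPart L M β U μ K n θ) (klLocalPart L₀ M₀ β U μ K n θ)
      rw [abs_sub_comm] at h1
      linarith
    linarith

/-- **COMPOSITION: the gen-3 counterterm child at the V11 bundle follows from the one-volume construction alone** (`CtOneVolumeMsV11` for all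
well-formed constants) — the volume transfer is proved above; the renormalisation package is `ctRenMs G` (Δ8: a function of `G` alone), the
common Matsubara threshold is `Mc L = max (Mh L) (Q.M0 β L)`; the package offered to `CountertermP2` is `ctRenMs G`. -/
theorem countertermP2_klPredsV11_of_ms (hone : ∀ G P Q, G.WF → P.WF → Q.WF → CtOneVolumeMsV11 G P Q) :
    CountertermP2 klPredsV11 klWindowC := by
  intro G P hG hP
  refine ⟨ctRenMs G, ctRenMs_WF2 hG, fun Q hQ => ?_⟩
  obtain ⟨c₁, hc₁, hc⟩ := hone G P Q hG hP hQ
  refine ⟨c₁, hc₁, fun c hc0 hcc => ?_⟩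
  obtain ⟨U₀, hU₀, hmain⟩ := hc c hc0 hcc
  refine ⟨U₀, hU₀, fun μ hμ U hU hUle β hβ hβc Lh Mh hhyp => ?_⟩
  have hyp : CtHypMsV11 G P Q β U μ Lh Mh := fun K hK L M _ _ hL hM n hn hren =>
    hhyp K hK L M hL hM n hn hren
  obtain ⟨K, hK, L₀, M₀, hL₀pos, hM₀pos, hL₀, hM₀, hM₀', hhalf⟩ := hmain μ hμ U hU hUle β hβ hβc Lh Mh hyp
  haveI : NeZero L₀ := ⟨Nat.pos_iff_ne_zero.mp hL₀pos⟩
  haveI : NeZero M₀ := ⟨Nat.pos_iff_ne_zero.mp hM₀pos⟩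
  refine ⟨K, hK, L₀, fun L => max (Mh L) (Q.M0 β L), fun L M _ _ hL hM n hn => ?_⟩
  exact ct_volumeTransferMsV11 G P Q hG hyp hK hL₀ hM₀ hM₀' (hhalf inferInstance inferInstance) L M hL hM n hn

end Summit.HubbardSuperconductivity.HubbardSuperconductivity.Theorems.KLRegimeSplit

end
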